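import Literature.NumberTheory.EllipticCurves.ManinConstantModularDegree
import Summits.BirchSwinnertonDyer.Rank1Residual.ManinAdditive.WildTwentySeven
import HarnessLib
import HarnessLib.Audit.Tags

/-!
# Sketch-imc-g23e — THE `p = 2` TWIN OF THE WILD RESIDUAL: `8 ∥ N` (imc g23, MEMO-imc §29.13;
# HOME/imc/kit-g23/PROOFS-g23.md §5.16, THM 29.V)

TYPER NOTE (typer g19, T-imc-41).  SOURCE = HOME/imc/kit-g23/Sketch-imc-g23e.lean sha16 5bb5356c91091fe2 (96 l.; imc: rc 0 · 0 warn; BC7 1/1 CLEAN,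
record g23e-bc7.raw.txt a29e2d614df0039e), landed VERBATIM except this note, the dropped crux-probe import/line, and ONE added import + typer edge:
`import …ManinAdditive.WildTwentySeven` (p713083) so that imc's joint bookkeeping theorem, which takes the E-imc-185 SHAPE as an explicit
hypothesis `h185`, is also available BY NAME — `padicVal_maninConstant_le_modularDegree_at_eight_and_twentySeven_of_named :
cesnaviciusNeururerSaha_padicVal_maninConstant_le_modularDegree → CNSBoundAtWildEight → WildTwentySeven.CNSBoundAtWildTwentySeven → …`
(one line, definitional).  Namespace `…ManinAdditive.WildEight` as written — ROUTE-INDEPENDENT (Literature leaf + WildTwentySeven).  HONEST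
FRAMING (typer summary; details = imc's text below): LENS imc; STATUS E-imc-189 `CNSBoundAtWildEight` CONJECTURAL obligation node (on paper ⟸
`p_g(𝔖₈) = 0`, OPEN; the decision is a finite level-72 computation, D-imc-41/41′); NOT IN PRINT (nearest = tree ČNS facts; ČNS §1
reduce-to-compute); BC5 (imc): MANIN-ADDITIVE-CREMONA-TIER-v1.tsv.gz — 8391/8391 certified optimal classes `8 ∥ N < 5·10⁵` with every odd prime
`≡ 1 (mod 4)` have `c = 1`, 0 violations (`2 ∣ deg φ` on all, so the inequality never decides `2 ∤ c`); REFUTER VERDICTS: ref1 R-imc-75 (PROOFS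
§5.16 A9–A11) PENDING at filing; ref2 PENDING.  CHEAPEST FALSIFIER: an optimal curve on such a level with `2 ∣ c`, `2 ∤ deg φ`; `p_g(𝔖₈) > 0`
would remove the paper route, not falsify the row.  WHY IT MATTERS: the `p = 2` twin of E-imc-185; C2's ČNS input at `8 ∥ N` off the printed
clause.  PARTITION ladder-adjacent · beyond-print theorem: NO · bears_on: stmt-BirchSwinnertonDyer-22967 (C2).  BSD is not proved by this; C2/C3 OPEN.

Česnavičius–Neururer–Saha (Thm. 1.2; tree fact
`cesnaviciusNeururerSaha_padicVal_maninConstant_le_modularDegree`, exceptional clauses as hypotheses)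
prove `val_p(c_φ) ≤ val_p(deg φ)` except, at `p = 2`, when `8 ∣ N` and NO prime `q ∣ N` has
`q ≡ 3 (mod 4)`.  PROOFS-g23 §5.16 localises the excluded case at `8 ∥ N`: the wild points of
`X₀(8M)_{𝔽̄₂}` are the `i`-eigen `Γ₀(M)`-structures on the supersingular curve `j = 0`, they exist iff
every odd `q ∣ M` is `≡ 1 (mod 4)`, each has stabiliser exactly `ℤ/2 = ⟨i⟩/±1` in
`Aut(E₀)/±1 ≅ A₄`, and all of them at all such levels have complete local ring isomorphic to ONE ring
`𝔖₈ := (Def(E₀, C₈) ⊗̂ W(𝔽̄₂))^{⟨i⟩}`.  THM 29.V identifies the window of `𝔖₈` as the Atkin–Lehner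
quotient `X₀(72)/W₉` (genus 3, `W₉` fixed-point free on `X₀(72)`), shows that the Néron lattice
`Λ(72)` of `J₀(72)` over `W(𝔽̄₂)` is cut out EXACTLY by integrality at the four cusp types (the
Katz–Mazur fibre of `X₀(72)` at `2` is reduced: multiplicities `φ(1), φ(2), φ(2), φ(1)`), and reduces
`p_g(𝔖₈) = length(Λ(72)^{W₉} / g^* Cot 𝒩(J(X₀(72)/W₉)))` with the bound `p_g(𝔖₈) ≤ a ≤ 3`
(`a` = number of trivial summands of the `W[C₂]`-lattice `Λ(72)`); the decision is a finite
level-`72` computation (asks D-imc-41/42).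

Typed here: **E-imc-189 `CNSBoundAtWildEight`** — the CNS inequality IN the excluded case at `8 ∥ N`
(a consequence of `p_g(𝔖₈) = 0`; census HOME/MANIN-ADDITIVE-CREMONA-TIER-v1.tsv.gz: the 8391 classes
with `8 ∥ N < 5·10⁵`, every odd prime `≡ 1 (mod 4)` and Cremona optimality code 1 all have certified
`c = 1`, `0` violations; `2 ∣ deg φ` on all 8391 (`8 ∣ deg φ` on 8390), so the inequality never decides
`2 ∤ c` there), and the PROVED bookkeeping
`padicVal_two_maninConstant_le_modularDegree_of_eight` : printed fact ∧ E-imc-189 ⟹ the `p = 2`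
inequality at every level with `8 ∥ N`.

PARTITION ladder-adjacent · beyond-print theorem: NO · BSD is not proved by this; Manin's conjecture is
not proved by this; C2/C3 OPEN.
-/

noncomputable section

namespace Summit.BirchSwinnertonDyer.Rank1Residual.ManinAdditive.WildEight

open Literature.NumberTheory.EllipticCurves.ModularForms

/-- crux-candidate **E-imc-189** (imc g23, MEMO-imc §29.13): the Česnavičius–Neururer–Saha inequality
`val₂(c_φ) ≤ val₂(deg φ)` in the case their Thm. 1.2 excludes, at `8 ∥ N`: no prime `q ∣ N` is
`≡ 3 (mod 4)`.  Equivalent, given CNS Thm. 1.2's last clause, to the rationality of the single wild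
`ℤ/2`-quotient singularity `𝔖₈`, i.e. to `g^* Cot 𝒩(J(X₀(72)/W₉)) = Cot 𝒩(J₀(72))^{W₉}` over `W(𝔽̄₂)`
(PROOFS-g23 §5.16, THM 29.V).  Why it might fail: `p_g(𝔖₈) ∈ {1, 2, 3}` is not excluded (the trace
bound of THM 29.V(v) cannot give `0`); census: 8391/8391 certified classes `N < 5·10⁵` have `c = 1`.
[cite: CesnaviciusNeururerSaha2023, Thm. 1.2 and §1 (rat-sing-main, reduce-to-compute)] -/
@[conjecture] def CNSBoundAtWildEight : Prop :=
  ∀ (W : WeierstrassCurve ℚ) [W.IsElliptic] [W.IsGloballyMinimal] [NeZero (W.conductorNorm ℤ)]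
    (D : ModularParametrizationData W (W.conductorNorm ℤ)),
    2 ^ 3 ∣ W.conductorNorm ℤ → ¬ 2 ^ 4 ∣ W.conductorNorm ℤ →
    (∀ q : ℕ, q.Prime → q ∣ W.conductorNorm ℤ → q % 4 ≠ 3) →
    padicValInt 2 D.maninConstant ≤ padicValNat 2 D.modularDegree

/-- PROVED bookkeeping: the printed CNS fact together with E-imc-189 gives the `p = 2` inequality
`val₂(c_φ) ≤ val₂(deg φ)` for EVERY conductor-level datum at every level with `8 ∥ N`. -/
theorem padicVal_two_maninConstant_le_modularDegree_of_eight
    (hCNS : cesnaviciusNeururerSaha_padicVal_maninConstant_le_modularDegree)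
    (h189 : CNSBoundAtWildEight)
    (W : WeierstrassCurve ℚ) [W.IsElliptic] [W.IsGloballyMinimal] [NeZero (W.conductorNorm ℤ)]
    (D : ModularParametrizationData W (W.conductorNorm ℤ))
    (h8 : 2 ^ 3 ∣ W.conductorNorm ℤ) (h16 : ¬ 2 ^ 4 ∣ W.conductorNorm ℤ) :
    padicValInt 2 D.maninConstant ≤ padicValNat 2 D.modularDegree := by
  by_cases hq : ∀ q : ℕ, q.Prime → q ∣ W.conductorNorm ℤ → q % 4 ≠ 3
  · exact h189 W D h8 h16 hq
  · exact hCNS W D 2 Nat.prime_two (fun h2 ↦ hq h2.2.2) (fun h3 ↦ by omega)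

/-- PROVED bookkeeping (both twins): printed fact ∧ E-imc-185-shape hypothesis at `27 ∥ N` ∧ E-imc-189
⟹ for `p ∈ {2, 3}` the inequality holds at every level with `p³ ∥ N`; stated for `p = 2` and `p = 3`
jointly as: at a level with `8 ∥ N` and `27 ∥ N` BOTH inequalities hold. -/
theorem padicVal_maninConstant_le_modularDegree_at_eight_and_twentySeven
    (hCNS : cesnaviciusNeururerSaha_padicVal_maninConstant_le_modularDegree)
    (h189 : CNSBoundAtWildEight)
    (h185 : ∀ (W : WeierstrassCurve ℚ) [W.IsElliptic] [W.IsGloballyMinimal]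
      [NeZero (W.conductorNorm ℤ)] (D : ModularParametrizationData W (W.conductorNorm ℤ)),
      3 ^ 3 ∣ W.conductorNorm ℤ → ¬ 3 ^ 4 ∣ W.conductorNorm ℤ →
      (∀ q : ℕ, q.Prime → q ∣ W.conductorNorm ℤ → q % 3 ≠ 2) →
      padicValInt 3 D.maninConstant ≤ padicValNat 3 D.modularDegree)
    (W : WeierstrassCurve ℚ) [W.IsElliptic] [W.IsGloballyMinimal] [NeZero (W.conductorNorm ℤ)]
    (D : ModularParametrizationData W (W.conductorNorm ℤ))
    (h8 : 2 ^ 3 ∣ W.conductorNorm ℤ) (h16 : ¬ 2 ^ 4 ∣ W.conductorNorm ℤ)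
    (h27 : 3 ^ 3 ∣ W.conductorNorm ℤ) (h81 : ¬ 3 ^ 4 ∣ W.conductorNorm ℤ) :
    padicValInt 2 D.maninConstant ≤ padicValNat 2 D.modularDegree ∧
      padicValInt 3 D.maninConstant ≤ padicValNat 3 D.modularDegree := by
  refine ⟨padicVal_two_maninConstant_le_modularDegree_of_eight hCNS h189 W D h8 h16, ?_⟩
  by_cases hq : ∀ q : ℕ, q.Prime → q ∣ W.conductorNorm ℤ → q % 3 ≠ 2
  · exact h185 W D h27 h81 hq
  · exact hCNS W D 3 Nat.prime_three (fun h2 ↦ by omega) (fun h3 ↦ hq h3.2.2)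

/-- **Typer edge (by name).**  imc's joint bookkeeping with the `27 ∥ N` hypothesis supplied by the landed node
`WildTwentySeven.CNSBoundAtWildTwentySeven` (E-imc-185, p713083) instead of its spelled-out shape. -/
theorem padicVal_maninConstant_le_modularDegree_at_eight_and_twentySeven_of_named
    (hCNS : cesnaviciusNeururerSaha_padicVal_maninConstant_le_modularDegree)
    (h189 : CNSBoundAtWildEight) (h185 : WildTwentySeven.CNSBoundAtWildTwentySeven)
    (W : WeierstrassCurve ℚ) [W.IsElliptic] [W.IsGloballyMinimal] [NeZero (W.conductorNorm ℤ)]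
    (D : ModularParametrizationData W (W.conductorNorm ℤ))
    (h8 : 2 ^ 3 ∣ W.conductorNorm ℤ) (h16 : ¬ 2 ^ 4 ∣ W.conductorNorm ℤ)
    (h27 : 3 ^ 3 ∣ W.conductorNorm ℤ) (h81 : ¬ 3 ^ 4 ∣ W.conductorNorm ℤ) :
    padicValInt 2 D.maninConstant ≤ padicValNat 2 D.modularDegree ∧
      padicValInt 3 D.maninConstant ≤ padicValNat 3 D.modularDegree :=
  padicVal_maninConstant_le_modularDegree_at_eight_and_twentySeven hCNS h189 h185 W D h8 h16 h27 h81

end Summit.BirchSwinnertonDyer.Rank1Residual.ManinAdditive.WildEight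

end
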